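import Mathlib
import Summits.NavierStokesRegularity.NavierStokesRegularity.Theorems.FilamentSkeletonRssKelvinGateCalculus
import Summits.NavierStokesRegularity.NavierStokesRegularity.Theorems.FilamentSkeletonRssStadiumDeviationPackage
import Summits.NavierStokesRegularity.NavierStokesRegularity.Theorems.FilamentSkeletonRssAreaLawSlavingHoloStadiumArea
import Literature.Algebra.EuclideanLattices.FccBccLattices

/-!
# The HOLOMORPHIC SLIP from strip propagation (`FilamentSkeletonRss`, child crux `TangentSkeletonNearStraight`,
# stmt-NavierStokesRegularity-28295, line `child_tangent_analytic_strip`; ∃-side glue between stub P2's OUTPUT and the landed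
# area-law capstone of stub P5)

The line propagates stadium analyticity of each filament curve (`StadiumAnalyticCurve`: a holomorphic `F` with `F t = cplx (X t)`,
`‖F′‖ ≤ 2`) and of the matched Biot–Savart field along it (stub P2's conclusion `StadiumAnalyticBdd`: a holomorphic `U` with
`U t = cplx (u X (X t))`, `‖U‖ ≤ B`).  The area block of the ∃-side (Theorems.AreaLawSlavingHolo…, parts 7–16: `stadium_analytic_area_of_real_slip`
and its Cauchy feeders) consumes a HOLOMORPHIC SLIP `w : ℂ → ℂ` on the stadium whose real trace is the crux's slip
`wj τ = ⟪v (X τ), X′ τ⟫`, `v y = u X y + ½ y − α e₃ × y`, with a sup bound (derivative bounds then follow between nested stadia by the landed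
Cauchy estimates).  This file is that glue, for one filament on one stadium `S = {|Im z| < h, |Re z − cc| < L + h}`:

* `hasDerivAt_coord_ofReal` — the complexified coordinates of a differentiable curve are differentiable, derivative `cplx (X′ t)`;
* `deriv_coord_ext_eq` — at a real point of the (open) stadium the complex derivative of a coordinate of the extension `F` IS the
  complexified real derivative: `deriv (F · i) t = (X′ t)_i` (restriction to `ℝ` + identity of the traces near `t` + uniqueness);
* `deriv_coord_eq_apply` / `norm_deriv_coord_le` — `deriv (F · i) z = (deriv F z) i`, hence `≤ ‖deriv F z‖`;
* `holo_slip_of_strip` — **the glue**: `W z = Σᵢ (Uᵢ + ½Fᵢ − α (e₃ ×_ℂ F)ᵢ)(z) · deriv Fᵢ z` is holomorphic on `S`, its real trace is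
  `((wj t : ℝ) : ℂ)`, and `‖W z‖ ≤ 6 (B + (1/2 + |α|) B_F)` from `‖U‖ ≤ B`, `‖F‖ ≤ B_F`, `‖F′‖ ≤ 2`.

HONEST FRAMING: bookkeeping serving a HYPOTHETICAL filament skeleton on the NEGATIVE side of a MODEL route (aside item); no registered stub
is closed by this file and nothing here bears on Navier–Stokes regularity or blow-up.  `--supports stmt-NavierStokesRegularity-28295`.
-/

set_option linter.dupNamespace false

noncomputable section

namespace Summit.NavierStokesRegularity.NavierStokesRegularity.Theorems.StadiumSlip

open Set Filter
open scoped InnerProductSpace Topology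
open Literature.Analysis.FluidPDE
open Summit.NavierStokesRegularity.NavierStokesRegularity.Theorems.StadiumDeviationPackage (inner_single_eq)
open Summit.NavierStokesRegularity.NavierStokesRegularity.Theorems.AreaLawSlavingHolo (thinStadium_isOpen)

/-! ## Coordinates of a real curve and of its holomorphic extension -/

/-- The complexified `i`-th coordinate of a curve differentiable at `t` is differentiable there, with derivative the
complexified coordinate of `deriv X t`. [folklore] -/
theorem hasDerivAt_coord_ofReal {X : ℝ → EuclideanSpace ℝ (Fin 3)} {t : ℝ} (hX : DifferentiableAt ℝ X t) (i : Fin 3) :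
    HasDerivAt (fun s : ℝ => ((X s i : ℝ) : ℂ)) ((deriv X t i : ℝ) : ℂ) t := by
  have h1 : HasDerivAt X (deriv X t) t := hX.hasDerivAt
  have h2 : HasDerivAt (fun s => X s i) (deriv X t i) t :=
    (PiLp.proj 2 (fun _ : Fin 3 => ℝ) i).hasFDerivAt.comp_hasDerivAt t h1
  exact h2.ofReal_comp

/-- At a real point of an open set `S ⊆ ℂ`, the complex derivative of the `i`-th coordinate of a holomorphic `F` whose real trace is
`cplx ∘ X` equals the complexified real derivative `(deriv X t)_i`. [folklore] -/
theorem deriv_coord_ext_eq {S : Set ℂ} (hSo : IsOpen S) {F : ℂ → (Fin 3 → ℂ)} (hF : DifferentiableOn ℂ F S)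
    {X : ℝ → EuclideanSpace ℝ (Fin 3)} (hX : Differentiable ℝ X)
    (hFX : ∀ t : ℝ, (t : ℂ) ∈ S → F t = fun i => ((⟪X t, EuclideanSpace.single i (1:ℝ)⟫_ℝ : ℝ) : ℂ))
    {t : ℝ} (ht : (t : ℂ) ∈ S) (i : Fin 3) :
    deriv (fun z => F z i) t = ((deriv X t i : ℝ) : ℂ) := by
  have hFi : DifferentiableOn ℂ (fun z => F z i) S := differentiableOn_pi.1 hF i
  have hd : HasDerivAt (fun z => F z i) (deriv (fun z => F z i) t) t :=
    ((hFi.differentiableAt (hSo.mem_nhds ht))).hasDerivAt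
  have hc : HasDerivAt (fun y : ℝ => (fun z => F z i) (y : ℂ)) (deriv (fun z => F z i) t) t := hd.comp_ofReal
  have hT : {y : ℝ | (y : ℂ) ∈ S} ∈ 𝓝 t := (hSo.preimage Complex.continuous_ofReal).mem_nhds ht
  have heq : (fun y : ℝ => ((X y i : ℝ) : ℂ)) =ᶠ[𝓝 t] (fun y : ℝ => (fun z => F z i) (y : ℂ)) := by
    filter_upwards [hT] with y hy
    simp only [hFX y hy, inner_single_eq]
  have h1 : HasDerivAt (fun y : ℝ => ((X y i : ℝ) : ℂ)) (deriv (fun z => F z i) t) t := hc.congr_of_eventuallyEq heq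
  exact (h1.unique (hasDerivAt_coord_ofReal (hX t) i)).symm ▸ rfl

/-- On an open set, the derivative of a coordinate of a holomorphic map is the coordinate of the derivative. [folklore] -/
theorem deriv_coord_eq_apply {S : Set ℂ} (hSo : IsOpen S) {F : ℂ → (Fin 3 → ℂ)} (hF : DifferentiableOn ℂ F S)
    {z : ℂ} (hz : z ∈ S) (i : Fin 3) : deriv (fun w => F w i) z = deriv F z i :=
  (hasDerivAt_pi.1 ((hF.differentiableAt (hSo.mem_nhds hz)).hasDerivAt) i).deriv

/-- Hence `‖deriv (F · i) z‖ ≤ ‖deriv F z‖` on the open set. [folklore] -/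
theorem norm_deriv_coord_le {S : Set ℂ} (hSo : IsOpen S) {F : ℂ → (Fin 3 → ℂ)} (hF : DifferentiableOn ℂ F S)
    {z : ℂ} (hz : z ∈ S) (i : Fin 3) : ‖deriv (fun w => F w i) z‖ ≤ ‖deriv F z‖ := by
  rw [deriv_coord_eq_apply hSo hF hz i]; exact norm_le_pi_norm _ i

/-- A coordinate of a holomorphic map is holomorphic, and so is its derivative (open set). [folklore] -/
theorem differentiableOn_deriv_coord {S : Set ℂ} (hSo : IsOpen S) {F : ℂ → (Fin 3 → ℂ)} (hF : DifferentiableOn ℂ F S)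
    (i : Fin 3) : DifferentiableOn ℂ (fun z => F z i) S ∧ DifferentiableOn ℂ (deriv (fun z => F z i)) S :=
  ⟨differentiableOn_pi.1 hF i, ((differentiableOn_pi.1 hF i).analyticOnNhd hSo).deriv.differentiableOn⟩

/-! ## The glue -/

/-- Coordinates of the transporting field along the filament: `(g + ½X − α e₃×X)_i`. [folklore] -/
theorem transport_coords (g x : EuclideanSpace ℝ (Fin 3)) (α : ℝ) :
    (g + (1/2:ℝ) • x - α • cross (EuclideanSpace.single 2 1) x) 0 = g 0 + 1/2 * x 0 + α * x 1 ∧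
    (g + (1/2:ℝ) • x - α • cross (EuclideanSpace.single 2 1) x) 1 = g 1 + 1/2 * x 1 - α * x 0 ∧
    (g + (1/2:ℝ) • x - α • cross (EuclideanSpace.single 2 1) x) 2 = g 2 + 1/2 * x 2 := by
  rw [KelvinGate.cross_single_two_eq_rotGen]
  refine ⟨?_, ?_, ?_⟩ <;> simp

/-- **The holomorphic slip from strip propagation.**  On the stadium `S = {|Im z| < h, |Re z − cc| < L + h}`: given the holomorphic
extension `F` of the curve (`F t = cplx (X t)`, `‖F‖ ≤ B_F`, `‖F′‖ ≤ 2`) and the holomorphic extension `U` of the induced velocity along it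
(`U t = cplx (g t)`, `‖U‖ ≤ B`; in the crux `g t = u X (X t)`, stub P2's output), the function
`W = (U₀ + ½F₀ + αF₁)·F₀′ + (U₁ + ½F₁ − αF₀)·F₁′ + (U₂ + ½F₂)·F₂′` is holomorphic on `S`, its real trace is the complexified slip
`⟪g t + ½ X t − α e₃ × X t, X′ t⟫`, and `‖W‖ ≤ 6 (B + (1/2 + |α|) B_F)` on `S`. [folklore] -/
theorem holo_slip_of_strip {h L cc α B BF : ℝ} {X g : ℝ → EuclideanSpace ℝ (Fin 3)} {F U : ℂ → (Fin 3 → ℂ)}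
    (hX : Differentiable ℝ X)
    (hF : DifferentiableOn ℂ F {z : ℂ | |z.im| < h ∧ |z.re - cc| < L + h})
    (hFX : ∀ t : ℝ, (t : ℂ) ∈ {z : ℂ | |z.im| < h ∧ |z.re - cc| < L + h} → F t = fun i => ((⟪X t, EuclideanSpace.single i (1:ℝ)⟫_ℝ : ℝ) : ℂ))
    (hFb : ∀ z ∈ {z : ℂ | |z.im| < h ∧ |z.re - cc| < L + h}, ‖F z‖ ≤ BF)
    (hF2 : ∀ z ∈ {z : ℂ | |z.im| < h ∧ |z.re - cc| < L + h}, ‖deriv F z‖ ≤ 2)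
    (hU : DifferentiableOn ℂ U {z : ℂ | |z.im| < h ∧ |z.re - cc| < L + h})
    (hUg : ∀ t : ℝ, (t : ℂ) ∈ {z : ℂ | |z.im| < h ∧ |z.re - cc| < L + h} → U t = fun i => ((⟪g t, EuclideanSpace.single i (1:ℝ)⟫_ℝ : ℝ) : ℂ))
    (hUb : ∀ z ∈ {z : ℂ | |z.im| < h ∧ |z.re - cc| < L + h}, ‖U z‖ ≤ B) :
    ∃ W : ℂ → ℂ, DifferentiableOn ℂ W {z : ℂ | |z.im| < h ∧ |z.re - cc| < L + h} ∧
      (∀ t : ℝ, (t : ℂ) ∈ {z : ℂ | |z.im| < h ∧ |z.re - cc| < L + h} →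
        W t = ((⟪g t + (1/2:ℝ) • X t - α • cross (EuclideanSpace.single 2 1) (X t), deriv X t⟫_ℝ : ℝ) : ℂ)) ∧
      ∀ z ∈ {z : ℂ | |z.im| < h ∧ |z.re - cc| < L + h}, ‖W z‖ ≤ 6 * (B + (1 / 2 + |α|) * BF) := by
  set S : Set ℂ := {z : ℂ | |z.im| < h ∧ |z.re - cc| < L + h} with hS
  have hSo : IsOpen S := thinStadium_isOpen h L cc
  -- coordinates and their derivatives
  set F0 : ℂ → ℂ := fun z => F z 0 with hF0
  set F1 : ℂ → ℂ := fun z => F z 1 with hF1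
  set F2' : ℂ → ℂ := fun z => F z 2 with hF2'
  obtain ⟨hF0d, hF0dd⟩ := differentiableOn_deriv_coord hSo hF 0
  obtain ⟨hF1d, hF1dd⟩ := differentiableOn_deriv_coord hSo hF 1
  obtain ⟨hF2d, hF2dd⟩ := differentiableOn_deriv_coord hSo hF 2
  have hU0d : DifferentiableOn ℂ (fun z => U z 0) S := differentiableOn_pi.1 hU 0
  have hU1d : DifferentiableOn ℂ (fun z => U z 1) S := differentiableOn_pi.1 hU 1
  have hU2d : DifferentiableOn ℂ (fun z => U z 2) S := differentiableOn_pi.1 hU 2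
  -- the slip
  refine ⟨fun z => (U z 0 + (1/2:ℂ) * F z 0 + (α:ℂ) * F z 1) * deriv (fun w => F w 0) z +
      (U z 1 + (1/2:ℂ) * F z 1 - (α:ℂ) * F z 0) * deriv (fun w => F w 1) z +
      (U z 2 + (1/2:ℂ) * F z 2) * deriv (fun w => F w 2) z, ?_, ?_, ?_⟩
  · -- holomorphy
    refine DifferentiableOn.add (DifferentiableOn.add ?_ ?_) ?_
    · exact ((hU0d.add (hF0d.const_mul _)).add (hF1d.const_mul _)).mul hF0dd
    · exact ((hU1d.add (hF1d.const_mul _)).sub (hF0d.const_mul _)).mul hF1dd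
    · exact (hU2d.add (hF2d.const_mul _)).mul hF2dd
  · -- real trace
    intro t ht
    have hd0 := deriv_coord_ext_eq hSo hF hX hFX ht 0
    have hd1 := deriv_coord_ext_eq hSo hF hX hFX ht 1
    have hd2 := deriv_coord_ext_eq hSo hF hX hFX ht 2
    have hUt : ∀ i, U t i = ((g t i : ℝ) : ℂ) := fun i => by rw [hUg t ht]; simp [inner_single_eq]
    have hFt : ∀ i, F t i = ((X t i : ℝ) : ℂ) := fun i => by rw [hFX t ht]; simp [inner_single_eq]
    obtain ⟨c0, c1, c2⟩ := transport_coords (g t) (X t) α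
    simp only []
    rw [hd0, hd1, hd2, hUt 0, hUt 1, hUt 2, hFt 0, hFt 1, hFt 2, Literature.Algebra.EuclideanLattices.inner_fin_three, c0, c1, c2]
    push_cast
    ring
  · -- the bound
    intro z hz
    have hUz : ∀ i, ‖U z i‖ ≤ B := fun i => (norm_le_pi_norm (U z) i).trans (hUb z hz)
    have hFz : ∀ i, ‖F z i‖ ≤ BF := fun i => (norm_le_pi_norm (F z) i).trans (hFb z hz)
    have hdz : ∀ i, ‖deriv (fun w => F w i) z‖ ≤ 2 := fun i => (norm_deriv_coord_le hSo hF hz i).trans (hF2 z hz)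
    have hB0 : 0 ≤ B := (norm_nonneg _).trans (hUz 0)
    have hBF0 : 0 ≤ BF := (norm_nonneg _).trans (hFz 0)
    have hα : ‖(α:ℂ)‖ = |α| := Complex.norm_real α
    have hhalf : ‖(1/2:ℂ)‖ = 1/2 := by norm_num
    -- each coefficient is bounded by `B + (1/2 + |α|) BF`
    have hc0 : ‖U z 0 + (1/2:ℂ) * F z 0 + (α:ℂ) * F z 1‖ ≤ B + (1/2 + |α|) * BF := by
      calc _ ≤ ‖U z 0 + (1/2:ℂ) * F z 0‖ + ‖(α:ℂ) * F z 1‖ := norm_add_le _ _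
        _ ≤ (‖U z 0‖ + ‖(1/2:ℂ) * F z 0‖) + ‖(α:ℂ) * F z 1‖ := by gcongr; exact norm_add_le _ _
        _ = ‖U z 0‖ + 1/2 * ‖F z 0‖ + |α| * ‖F z 1‖ := by rw [norm_mul, norm_mul, hα, hhalf]
        _ ≤ B + 1/2 * BF + |α| * BF :=
            add_le_add (add_le_add (hUz 0) (mul_le_mul_of_nonneg_left (hFz 0) (by norm_num)))
              (mul_le_mul_of_nonneg_left (hFz 1) (abs_nonneg α))
        _ = B + (1/2 + |α|) * BF := by ring
    have hc1 : ‖U z 1 + (1/2:ℂ) * F z 1 - (α:ℂ) * F z 0‖ ≤ B + (1/2 + |α|) * BF := by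
      calc _ ≤ ‖U z 1 + (1/2:ℂ) * F z 1‖ + ‖(α:ℂ) * F z 0‖ := norm_sub_le _ _
        _ ≤ (‖U z 1‖ + ‖(1/2:ℂ) * F z 1‖) + ‖(α:ℂ) * F z 0‖ := by gcongr; exact norm_add_le _ _
        _ = ‖U z 1‖ + 1/2 * ‖F z 1‖ + |α| * ‖F z 0‖ := by rw [norm_mul, norm_mul, hα, hhalf]
        _ ≤ B + 1/2 * BF + |α| * BF :=
            add_le_add (add_le_add (hUz 1) (mul_le_mul_of_nonneg_left (hFz 1) (by norm_num)))
              (mul_le_mul_of_nonneg_left (hFz 0) (abs_nonneg α))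
        _ = B + (1/2 + |α|) * BF := by ring
    have hc2 : ‖U z 2 + (1/2:ℂ) * F z 2‖ ≤ B + (1/2 + |α|) * BF := by
      calc _ ≤ ‖U z 2‖ + ‖(1/2:ℂ) * F z 2‖ := norm_add_le _ _
        _ = ‖U z 2‖ + 1/2 * ‖F z 2‖ := by rw [norm_mul, hhalf]
        _ ≤ B + 1/2 * BF := add_le_add (hUz 2) (mul_le_mul_of_nonneg_left (hFz 2) (by norm_num))
        _ ≤ B + (1/2 + |α|) * BF := by nlinarith [abs_nonneg α]
    have hK0 : 0 ≤ B + (1/2 + |α|) * BF := by positivity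
    have hterm : ∀ (a b : ℂ), ‖a‖ ≤ B + (1/2 + |α|) * BF → ‖b‖ ≤ 2 → ‖a * b‖ ≤ (B + (1/2 + |α|) * BF) * 2 := by
      intro a b ha hb
      rw [norm_mul]; exact mul_le_mul ha hb (norm_nonneg _) hK0
    calc _ ≤ ‖(U z 0 + (1/2:ℂ) * F z 0 + (α:ℂ) * F z 1) * deriv (fun w => F w 0) z +
            (U z 1 + (1/2:ℂ) * F z 1 - (α:ℂ) * F z 0) * deriv (fun w => F w 1) z‖ +
          ‖(U z 2 + (1/2:ℂ) * F z 2) * deriv (fun w => F w 2) z‖ := norm_add_le _ _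
      _ ≤ (‖(U z 0 + (1/2:ℂ) * F z 0 + (α:ℂ) * F z 1) * deriv (fun w => F w 0) z‖ +
            ‖(U z 1 + (1/2:ℂ) * F z 1 - (α:ℂ) * F z 0) * deriv (fun w => F w 1) z‖) +
          ‖(U z 2 + (1/2:ℂ) * F z 2) * deriv (fun w => F w 2) z‖ := by gcongr; exact norm_add_le _ _
      _ ≤ ((B + (1/2 + |α|) * BF) * 2 + (B + (1/2 + |α|) * BF) * 2) + (B + (1/2 + |α|) * BF) * 2 := by
          gcongr
          · exact hterm _ _ hc0 (hdz 0)
          · exact hterm _ _ hc1 (hdz 1)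
          · exact hterm _ _ hc2 (hdz 2)
      _ = 6 * (B + (1 / 2 + |α|) * BF) := by ring

end Summit.NavierStokesRegularity.NavierStokesRegularity.Theorems.StadiumSlip

end
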